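import Mathlib
import Literature.NumberTheory.LFunctions.Zhang2022.Section8XiZeroTailMean
import HarnessLib

/-!
# Zhang (2022) §7 Prop. 7.1: the polylogarithmic bound `|S_j(𝐚₁,𝐚₂)| ≪ 𝓛⁷²` for admissible sequences

Topic `Literature/NumberTheory/LFunctions/Zhang2022` (Landau–Siegel audit tree; verdict-neutral).
Y. Zhang, *Discrete mean estimates and the Landau–Siegel zero*, arXiv:2211.02515v1 (2022)
[Zhang2022LandauSiegel], §7 p. 33, Proposition 7.1 (the arithmetic sums
`S_j(𝐚₁,𝐚₂) = Σ_dΣ_r |μ(r)|λ₀ⱼ(dr)/(drφ(r)) (Σ_m a₁(drm)m^{−(1−β_j)})(Σ_n a₂(drn)ξ₀ⱼ(n;d,r)/n)`,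
hypothesis (7.2) `|a(n)| ≤ 1`, `a(n) = 0` for `n ≥ PT⁻²`) and §11 p. 65 ("… by (8.25), (8.26) and
simple estimates", tex L3348–3352) — **an unrefereed manuscript under adjudication** (campaign
D-0069). The §11 step was reduced in the kernel (`Section11E2MeanSquare`, sz-d36) to Lemma 8.1,
Prop. 7.1 and the hypothesis "`|S_j(𝐚₁,𝐚₂)| ≤ K𝓛^B` (`B ≤ 86`) for all `(7.2)`-admissible
`𝐚₁, 𝐚₂` with `|a| ≤ 1`". THIS FILE PROVES that hypothesis with `B = 72` (`sjPolylog`), by the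
multiplicative-majorant engine of `Section8XiZeroMajorant` / `Section8XiZeroTailMean`, here in
its `T`-free form (no smallness of the shifts is needed once `log q`-accuracy is given up):

* `|1 − q^{−(1+it)}| ∈ [1 − 1/q, 1 + 1/q]` for every real `t`, hence
  `|λ(m, 1−β_j)| ≤ Λc(m) := ∏_{q∣m}(1 + 12/q)` for EVERY `m ≥ 1` and `|λ̃₀ⱼ(n,dr)| ≤ Λc(n)`;
* `gC := Λc·(w ∗ Kmaj) ≥ |ξ₀ⱼ(·;d,r)|` on all of `ℕ_{≥1}` (uniformly in `d, r, j`), multiplicative,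
  `gC(p) ≤ 5 + (60 + 7M₀)/p` (`|κ(p)| ≤ 4`), `gC(p^ν) ≤ 7(2+S₃)(ν+1)⁴`; so
  `Σ_{n≤X}|ξ₀ⱼ(n;d,r)|/n ≤ C₁(log X)⁵`, `Σ_{d≤X}Λc(d)/d ≤ C₂ log X`, `Σ_{m≤X} 1/m ≤ C₃ log X`;
* `|S_j(𝐚₁,𝐚₂)| ≤ (Σ_dΛc(d)/d)(Σ_rΛc(r)/r)(Σ_m 1/m)·max_{d,r}Σ_n|ξ₀ⱼ|/n ≤ K₀(log N)⁸`,
  `N = ⌈PT⁻²⌉ ≤ 2P`, `log N ≤ 2𝓛⁹`, whence `≤ K·𝓛⁷²`.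

No statement about the manuscript's Theorems 1–2 or about Landau–Siegel zeros is made or implied.

## References

* Y. Zhang, arXiv:2211.02515v1 (2022), §7 p. 33 (Prop. 7.1, (7.2)); §11 p. 65.
  [cite: Zhang2022LandauSiegel, §7 Prop. 7.1 p.33; §11 p.65]
* R. R. Hall, G. Tenenbaum, *Divisors* (CUP 1988), (0.4). [cite: HallTenenbaum1988, (0.4)]
-/

noncomputable section

open Finset Real ArithmeticFunction

namespace Literature.NumberTheory.LFunctions.Zhang2022.XiZeroMajorant

open MeanSquareMajorant

variable (c' : ℝ) (D : ℕ)

/-! ### Part 1. Crude (shift-free) bounds for the Euler factors of `λ` -/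

/-- `‖1 − q^{−(1+it)}‖ ∈ [1 − 1/q, 1 + 1/q]` for `q ≥ 1` and every real `t` (`|q^{−(1+it)}| = 1/q`).
[cite: Zhang2022LandauSiegel, §7 p.33] -/
theorem norm_one_sub_cpow_crude {q : ℕ} (hq : 1 ≤ q) (t : ℝ) :
    1 - 1 / (q : ℝ) ≤ ‖1 - (q : ℂ) ^ (-(1 + t * Complex.I))‖ ∧
      ‖1 - (q : ℂ) ^ (-(1 + t * Complex.I))‖ ≤ 1 + 1 / (q : ℝ) := by
  have hqpos : 0 < q := hq
  have hz : ‖(q : ℂ) ^ (-(1 + t * Complex.I))‖ = 1 / (q : ℝ) := by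
    rw [Complex.norm_natCast_cpow_of_pos hqpos]
    simp [Real.rpow_neg_one]
  constructor
  · have h := norm_sub_norm_le (1 : ℂ) ((q : ℂ) ^ (-(1 + t * Complex.I)))
    rw [norm_one, hz] at h
    exact h
  · calc ‖1 - (q : ℂ) ^ (-(1 + t * Complex.I))‖
        ≤ ‖(1 : ℂ)‖ + ‖(q : ℂ) ^ (-(1 + t * Complex.I))‖ := norm_sub_le _ _
      _ = 1 + 1 / (q : ℝ) := by rw [norm_one, hz]

omit c' D in
/-- `n₁n₂n₃/dd ≤ 1 + 12/q` when `0 ≤ n_i ≤ 1 + 1/q`, `dd ≥ 1 − 1/q`, `q ≥ 2`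
(`(1+u)³ ≤ (1+12u)(1−u)` for `u ≤ 1/2`). [cite: Zhang2022LandauSiegel, §7 p.33] -/
theorem crude_ratio_le {q : ℝ} (hq : 2 ≤ q) {n₁ n₂ n₃ dd : ℝ} (h₁ : n₁ ≤ 1 + 1 / q)
    (h₂ : n₂ ≤ 1 + 1 / q) (h₃ : n₃ ≤ 1 + 1 / q) (hn₁ : 0 ≤ n₁) (hn₂ : 0 ≤ n₂)
    (hdd : 1 - 1 / q ≤ dd) : n₁ * n₂ * n₃ / dd ≤ 1 + 12 / q := by
  set u : ℝ := 1 / q with hu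
  have hu0 : 0 < u := by rw [hu]; positivity
  have hu2 : u ≤ 1 / 2 := by rw [hu]; exact one_div_le_one_div_of_le two_pos hq
  have hddpos : 0 < dd := by linarith
  rw [div_le_iff₀ hddpos]
  have hprod : n₁ * n₂ * n₃ ≤ (1 + u) ^ 3 := by
    have h12 : n₁ * n₂ ≤ (1 + u) ^ 2 := by nlinarith
    nlinarith [mul_nonneg hn₁ hn₂]
  have hkey : (1 + u) ^ 3 ≤ (1 + 12 * u) * (1 - u) := by
    have h1 : 0 ≤ 8 - 15 * u - u ^ 2 := by nlinarith
    nlinarith [mul_nonneg hu0.le h1]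
  have h12u : 12 / q = 12 * u := by rw [hu]; ring
  rw [h12u]
  calc n₁ * n₂ * n₃ ≤ (1 + u) ^ 3 := hprod
    _ ≤ (1 + 12 * u) * (1 - u) := hkey
    _ ≤ (1 + 12 * u) * dd := mul_le_mul_of_nonneg_left hdd (by positivity)

/-- **`|λ(m, 1−β_j)| ≤ Λc(m) = ∏_{q∣m}(1 + 12/q)`** for every `m` and every `j` (no smallness of
the shifts: each Euler factor is `∏_i(1 − q^{−(1+i(b_i−b_j))})/(1 − q^{−(1−ib_j)})`, of modulus
`≤ (1+1/q)³/(1−1/q) ≤ 1 + 12/q`). [cite: Zhang2022LandauSiegel, §7 p.33] -/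
theorem norm_lam_le_prod (m j : ℕ) :
    ‖Skeleton.lam c' D m (1 - Skeleton.betaJ c' D j)‖ ≤
      ∏ q ∈ m.primeFactors, (1 + 12 / (q : ℝ)) := by
  rw [Skeleton.lam, norm_prod]
  refine prod_le_prod (fun q _ => norm_nonneg _) fun q hq => ?_
  have hqp : q.Prime := Nat.prime_of_mem_primeFactors hq
  have hq1 : 1 ≤ q := hqp.one_lt.le
  have hqr : (2 : ℝ) ≤ q := by exact_mod_cast hqp.two_le
  set s : ℂ := 1 - Skeleton.betaJ c' D j with hs
  have hexp : ∀ b : ℝ, -(s + (b : ℂ) * Complex.I) =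
      -(1 + ((b - bJ c' D j : ℝ) : ℂ) * Complex.I) := by
    intro b; rw [hs, betaJ_eq]; push_cast; ring
  have hexp0 : -s = -(1 + ((-bJ c' D j : ℝ) : ℂ) * Complex.I) := by
    rw [hs, betaJ_eq]; push_cast; ring
  rw [beta1_eq, beta2_eq, beta3_eq, hexp, hexp, hexp, hexp0, norm_div, norm_mul, norm_mul]
  exact crude_ratio_le hqr (norm_one_sub_cpow_crude hq1 _).2 (norm_one_sub_cpow_crude hq1 _).2
    (norm_one_sub_cpow_crude hq1 _).2 (norm_nonneg _) (norm_nonneg _)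
    (norm_one_sub_cpow_crude hq1 _).1

/-! ### Part 2. The `T`-free majorant `gC = Λc·(w ∗ Kmaj)` of `ξ₀ⱼ` -/

omit c' D in
/-- `Λc(n) = ∏_{q∣n}(1 + 12/q)` (`0 ↦ 0`). [cite: Zhang2022LandauSiegel, §7 p.33] -/
def LamC : ArithmeticFunction ℝ :=
  ⟨fun n => if n = 0 then 0 else ∏ q ∈ n.primeFactors, (1 + 12 / (q : ℝ)), if_pos rfl⟩

omit c' D in
/-- `Λc(n)` for `n ≠ 0`. [cite: Zhang2022LandauSiegel, §7 p.33] -/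
theorem LamC_apply {n : ℕ} (hn : n ≠ 0) : LamC n = ∏ q ∈ n.primeFactors, (1 + 12 / (q : ℝ)) := by
  rw [LamC]; exact if_neg hn

omit c' D in
/-- Each factor `1 + 12/q ≥ 1`. [cite: Zhang2022LandauSiegel, §7 p.33] -/
theorem one_le_LamC_factor (q : ℕ) : (1 : ℝ) ≤ 1 + 12 / (q : ℝ) := by
  have : (0 : ℝ) ≤ 12 / (q : ℝ) := by positivity
  linarith

omit c' D in
/-- `Λc` is multiplicative. [cite: Zhang2022LandauSiegel, §7 p.33] -/
theorem isMultiplicative_LamC : LamC.IsMultiplicative := by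
  rw [IsMultiplicative.iff_ne_zero]
  refine ⟨by simp [LamC], fun {m n} hm hn hmn => ?_⟩
  rw [LamC_apply (mul_ne_zero hm hn), LamC_apply hm, LamC_apply hn,
    Nat.primeFactors_mul hm hn, prod_union (Nat.Coprime.disjoint_primeFactors hmn)]

omit c' D in
/-- `1 ≤ Λc(n)` for `n ≠ 0` (in particular `0 ≤ Λc`). [cite: Zhang2022LandauSiegel, §7 p.33] -/
theorem one_le_LamC {n : ℕ} (hn : n ≠ 0) : 1 ≤ LamC n := by
  rw [LamC_apply hn]
  calc (1 : ℝ) = ∏ q ∈ n.primeFactors, (1 : ℝ) := by simp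
    _ ≤ _ := prod_le_prod (fun _ _ => zero_le_one) fun q _ => one_le_LamC_factor q

omit c' D in
/-- `0 ≤ Λc(n)`. [cite: Zhang2022LandauSiegel, §7 p.33] -/
theorem LamC_nonneg (n : ℕ) : 0 ≤ LamC n := by
  rcases eq_or_ne n 0 with rfl | hn
  · simp [LamC]
  · linarith [one_le_LamC hn]

omit c' D in
/-- **Submultiplicativity**: `Λc(mn) ≤ Λc(m)Λc(n)` for all `m, n ≠ 0` (all factors are `≥ 1`).
[cite: Zhang2022LandauSiegel, §7 p.33] -/
theorem LamC_mul_le {m n : ℕ} (hm : m ≠ 0) (hn : n ≠ 0) : LamC (m * n) ≤ LamC m * LamC n := by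
  rw [LamC_apply (mul_ne_zero hm hn), LamC_apply hm, LamC_apply hn, Nat.primeFactors_mul hm hn,
    ← prod_union_inter]
  have h1 : (1 : ℝ) ≤ ∏ q ∈ m.primeFactors ∩ n.primeFactors, (1 + 12 / (q : ℝ)) := by
    calc (1 : ℝ) = ∏ q ∈ m.primeFactors ∩ n.primeFactors, (1 : ℝ) := by simp
      _ ≤ _ := prod_le_prod (fun _ _ => zero_le_one) fun q _ => one_le_LamC_factor q
  have h0 : 0 ≤ ∏ q ∈ m.primeFactors ∪ n.primeFactors, (1 + 12 / (q : ℝ)) :=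
    prod_nonneg fun q _ => by linarith [one_le_LamC_factor q]
  exact le_mul_of_one_le_right h0 h1

/-- **`|λ₀ⱼ(m)| ≤ Λc(m)`** for every `m ≠ 0`, `j`. [cite: Zhang2022LandauSiegel, §7 p.33] -/
theorem norm_lamZero_le_LamC {m : ℕ} (hm : m ≠ 0) (j : ℕ) :
    ‖Skeleton.lamZero c' D j m‖ ≤ LamC m := by
  rw [Skeleton.lamZero, LamC_apply hm]; exact norm_lam_le_prod c' D m j

/-- **`|λ̃₀ⱼ(n,dr)| ≤ Λc(n)`** for every `n ≠ 0` (no hypothesis on the shifts).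
[cite: Zhang2022LandauSiegel, §7 p.33] -/
theorem norm_lamTildeZero_le_LamC {n : ℕ} (hn : n ≠ 0) (j dr : ℕ) :
    ‖Skeleton.lamTildeZero c' D j n dr‖ ≤ LamC n := by
  classical
  have hS : n.primeFactors.filter (fun q => Nat.Coprime q dr) ⊆ n.primeFactors :=
    filter_subset _ _
  rw [Skeleton.lamTildeZero, norm_prod, LamC_apply hn, ← prod_sdiff hS]
  set S := n.primeFactors.filter (fun q => Nat.Coprime q dr) with hSdef
  have h1 : ∏ q ∈ S, ‖Skeleton.lamZero c' D j q‖ ≤ ∏ q ∈ S, (1 + 12 / (q : ℝ)) :=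
    prod_le_prod (fun q _ => norm_nonneg _) fun q hq => by
      have hqp := Nat.prime_of_mem_primeFactors (hS hq)
      have h := norm_lamZero_le_LamC c' D hqp.ne_zero j
      rwa [LamC_apply hqp.ne_zero, hqp.primeFactors, prod_singleton] at h
  have hge1 : (1 : ℝ) ≤ ∏ q ∈ (n.primeFactors \ S), (1 + 12 / (q : ℝ)) := by
    calc (1 : ℝ) = ∏ q ∈ (n.primeFactors \ S), (1 : ℝ) := by simp
      _ ≤ _ := prod_le_prod (fun _ _ => zero_le_one) fun q _ => one_le_LamC_factor q
  have hnn : 0 ≤ ∏ q ∈ S, (1 + 12 / (q : ℝ)) :=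
    prod_nonneg fun q _ => by linarith [one_le_LamC_factor q]
  exact h1.trans (le_mul_of_one_le_left hnn hge1)

/-- **The `T`-free majorant `gC = Λc · (w ∗ Kmaj)`** of `|ξ₀ⱼ(·;d,r)|`.
[cite: Zhang2022LandauSiegel, §7 p.33] -/
def gC : ArithmeticFunction ℝ := LamC.pmul (Wt * KA c' D)

/-- `gC` is multiplicative. [cite: Zhang2022LandauSiegel, §7 p.33] -/
theorem isMultiplicative_gC : (gC c' D).IsMultiplicative :=
  isMultiplicative_LamC.pmul (isMultiplicative_Wt.mul (isMultiplicative_KA c' D))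

/-- `0 ≤ gC(n)`. [cite: Zhang2022LandauSiegel, §7 p.33] -/
theorem gC_nonneg (n : ℕ) : 0 ≤ gC c' D n := by
  rw [gC, pmul_apply]; exact mul_nonneg (LamC_nonneg n) (WK_nonneg c' D n)

/-- **`|ξ₀ⱼ(n;d,r)| ≤ gC(n)`** for every `n ≠ 0` (any `j, d, r`; no hypothesis on `D`).
[cite: Zhang2022LandauSiegel, §7 p.33] -/
theorem norm_xiZero_le_gC {n : ℕ} (hn : n ≠ 0) (j d r : ℕ) :
    ‖Skeleton.xiZero c' D j n d r‖ ≤ gC c' D n := by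
  rw [Skeleton.xiZero, norm_mul, gC, pmul_apply, WK_apply]
  refine mul_le_mul (norm_lamTildeZero_le_LamC c' D hn j (d * r)) ?_ (norm_nonneg _)
    (LamC_nonneg n)
  calc ‖∑ k ∈ n.divisors.filter (fun k => Nat.Coprime k r),
          Skeleton.kappaTildeZero c' D j (n / k) (d * r * k) * (ArithmeticFunction.moebius k : ℂ) *
            (k : ℂ) ^ (1 - Skeleton.betaJ c' D j) / (Nat.totient k : ℂ)‖
      ≤ ∑ k ∈ n.divisors.filter (fun k => Nat.Coprime k r),
          ‖Skeleton.kappaTildeZero c' D j (n / k) (d * r * k) * (ArithmeticFunction.moebius k : ℂ) *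
            (k : ℂ) ^ (1 - Skeleton.betaJ c' D j) / (Nat.totient k : ℂ)‖ := norm_sum_le _ _
    _ ≤ ∑ k ∈ n.divisors.filter (fun k => Nat.Coprime k r), Wt k * KA c' D (n / k) :=
        sum_le_sum fun k hk => norm_xiZero_term_le c' D hn j d r (mem_filter.mp hk).1
    _ ≤ ∑ k ∈ n.divisors, Wt k * KA c' D (n / k) :=
        sum_le_sum_of_subset_of_nonneg (filter_subset _ _)
          fun k _ _ => mul_nonneg (Wt_nonneg k) (KA_nonneg c' D _)

/-! ### Part 3. The values of `gC` and `Λc` at primes and prime powers; the three mean values -/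

omit c' D in
/-- `Λc(p^ν) = 1 + 12/p ≤ 7` (`ν ≥ 1`), `Λc(1) = 1`. [cite: Zhang2022LandauSiegel, §7 p.33] -/
theorem LamC_prime_pow_le {p : ℕ} (hp : p.Prime) (ν : ℕ) : LamC (p ^ ν) ≤ 7 := by
  have hp2 : (2 : ℝ) ≤ p := by exact_mod_cast hp.two_le
  rcases Nat.eq_zero_or_pos ν with rfl | hν
  · rw [pow_zero, isMultiplicative_LamC.map_one]; norm_num
  · rw [LamC_apply (pow_ne_zero ν hp.ne_zero), Nat.primeFactors_prime_pow hν.ne' hp, prod_singleton]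
    have : 12 / (p : ℝ) ≤ 6 := by
      rw [div_le_iff₀ (by linarith)]; linarith
    linarith

/-- `gC(p) ≤ 5 + (60 + 7M₀)/p` at every prime (`Kmaj p ≤ 4 + 8S₃/p`, `w(p) = p/(p−1) ≤ 1 + 2/p`,
`Λc(p) = 1 + 12/p`). [cite: Zhang2022LandauSiegel, §7 p.33] -/
theorem gC_prime_le {p : ℕ} (hp : p.Prime) : gC c' D p ≤ 5 + (60 + 7 * M0) / p := by
  have hT := LogEulerProduct.tailConst_nonneg 3
  have hM0 := M0_nonneg
  have hp2 : (2 : ℝ) ≤ p := by exact_mod_cast hp.two_le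
  have hppos : (0 : ℝ) < p := by linarith
  have hLam : LamC p = 1 + 12 / (p : ℝ) := by
    rw [LamC_apply hp.ne_zero, hp.primeFactors, prod_singleton]
  have hWK : (Wt * KA c' D) p = Wt p + KA c' D p :=
    mul_apply_prime isMultiplicative_Wt.map_one (isMultiplicative_KA c' D).map_one hp
  have hW : Wt p ≤ 1 + 2 / p := by
    rw [Wt_apply, ArithmeticFunction.moebius_apply_prime hp, Nat.totient_prime hp]
    simp only [Int.reduceNeg, Int.natAbs_neg, Int.natAbs_one, Nat.cast_one, one_mul]
    push_cast [Nat.cast_sub hp.one_le]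
    have hp1 : (0 : ℝ) < (p : ℝ) - 1 := by linarith
    have e1 : 1 + 1 / ((p : ℝ) - 1) = p / (p - 1) := by
      rw [add_div' _ _ _ hp1.ne']; congr 1; ring
    have e2 : 1 / ((p : ℝ) - 1) ≤ 2 / p := by
      rw [div_le_div_iff₀ hp1 hppos]; linarith
    linarith
  have hK : KA c' D p ≤ 4 + 8 * LogEulerProduct.tailConst 3 / p := by
    rw [KA_apply c' D hp.ne_zero]
    have h := Kmaj_prime_pow c' D hp one_ne_zero
    rw [pow_one] at h
    rw [h]
    refine (locK_le c' D hp 1).trans ?_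
    rw [pow_one]
    have hκ : ‖Skeleton.kappaZ c' D p‖ ≤ 4 := by
      rw [Skeleton.kappaZ]; exact norm_kappa_prime_le_four _ _ _ hp
    have : (((1 : ℕ) : ℝ) + 1) ^ 3 * LogEulerProduct.tailConst 3 / p =
        8 * LogEulerProduct.tailConst 3 / p := by norm_num
    rw [this]; linarith
  rw [gC, pmul_apply, hLam, hWK]
  have hsum : Wt p + KA c' D p ≤ 5 + M0 / p := by
    have : M0 / p = 2 / p + 8 * LogEulerProduct.tailConst 3 / p := by rw [M0]; ring
    rw [this]; linarith
  have hsum0 : 0 ≤ Wt p + KA c' D p := add_nonneg (Wt_nonneg p) (KA_nonneg c' D p)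
  have hMp : M0 / p ≤ M0 / 2 := div_le_div_of_nonneg_left hM0 two_pos hp2
  have h12 : 0 ≤ 12 / (p : ℝ) := by positivity
  calc (1 + 12 / (p : ℝ)) * (Wt p + KA c' D p) ≤ (1 + 12 / (p : ℝ)) * (5 + M0 / p) :=
        mul_le_mul_of_nonneg_left hsum (by positivity)
    _ = 5 + M0 / p + 12 / p * (5 + M0 / p) := by ring
    _ ≤ 5 + M0 / p + 12 / p * (5 + M0 / 2) := by gcongr
    _ = 5 + (60 + 7 * M0) / p := by ring

/-- `gC(p^ν) ≤ 7(2 + S₃)(ν+1)⁴` at prime powers. [cite: Zhang2022LandauSiegel, §7 p.33] -/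
theorem gC_prime_pow_le {p : ℕ} (hp : p.Prime) (ν : ℕ) :
    gC c' D (p ^ ν) ≤ 7 * (2 + LogEulerProduct.tailConst 3) * ((ν : ℝ) + 1) ^ 4 := by
  have hT := LogEulerProduct.tailConst_nonneg 3
  rw [gC, pmul_apply]
  calc LamC (p ^ ν) * (Wt * KA c' D) (p ^ ν)
      ≤ 7 * ((2 + LogEulerProduct.tailConst 3) * ((ν : ℝ) + 1) ^ 4) :=
        mul_le_mul (LamC_prime_pow_le hp ν) (WK_prime_pow_le c' D hp ν) (WK_nonneg c' D _)
          (by norm_num)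
    _ = _ := by ring

/-- The local series of `gC` converges at every prime. [cite: Zhang2022LandauSiegel, §7 p.33] -/
theorem summable_gC_local {p : ℕ} (hp : p.Prime) :
    Summable fun ν : ℕ => gC c' D (p ^ ν) / (p : ℝ) ^ ν := by
  have hT := LogEulerProduct.tailConst_nonneg 3
  have hp2 : (2 : ℝ) ≤ p := by exact_mod_cast hp.two_le
  have hbound : ∀ ν : ℕ, gC c' D (p ^ ν) / (p : ℝ) ^ ν ≤
      7 * (2 + LogEulerProduct.tailConst 3) * (((ν : ℝ) + 3) ^ 4 * (1 / 2 : ℝ) ^ ν) := by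
    intro ν
    have hppos : (0 : ℝ) < (p : ℝ) ^ ν := by positivity
    rw [div_le_iff₀ hppos]
    have h1 : (1 : ℝ) ≤ (1 / 2 : ℝ) ^ ν * (p : ℝ) ^ ν := by
      rw [← mul_pow]; exact one_le_pow₀ (by linarith)
    have h3 : ((ν : ℝ) + 1) ^ 4 ≤ ((ν : ℝ) + 3) ^ 4 :=
      pow_le_pow_left₀ (by positivity) (by linarith) 4
    calc gC c' D (p ^ ν) ≤ 7 * (2 + LogEulerProduct.tailConst 3) * ((ν : ℝ) + 1) ^ 4 :=
          gC_prime_pow_le c' D hp ν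
      _ ≤ 7 * (2 + LogEulerProduct.tailConst 3) * ((ν : ℝ) + 3) ^ 4 := by gcongr
      _ ≤ 7 * (2 + LogEulerProduct.tailConst 3) * ((ν : ℝ) + 3) ^ 4 *
            ((1 / 2 : ℝ) ^ ν * (p : ℝ) ^ ν) := le_mul_of_one_le_right (by positivity) h1
      _ = _ := by ring
  exact Summable.of_nonneg_of_le (fun ν => div_nonneg (gC_nonneg c' D _) (by positivity))
    hbound ((LogEulerProduct.summable_tailConst 4).mul_left _)

/-- **The `T`-free logarithmic mean of `ξ₀ⱼ`**: for `X ≥ 2` and all `d, r, j`,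
`Σ_{n≤X} |ξ₀ⱼ(n;d,r)|/n ≤ exp(20 + 0·log(4X) + (60+7M₀) + 7(2+S₃)S₄)·(log X)⁵` (valid for every
`X`, no `x ≤ T` restriction, at the price of the exponent `5` instead of `3`).
[cite: Zhang2022LandauSiegel, §7 p.33] -/
theorem sum_norm_xiZero_div_le {X : ℕ} (hX : 2 ≤ X) (j d r : ℕ) :
    ∑ n ∈ Icc 1 X, ‖Skeleton.xiZero c' D j n d r‖ / n ≤
      Real.exp (4 * (5 : ℕ) + 0 * Real.log (4 * X) + (60 + 7 * M0) +
        7 * (2 + LogEulerProduct.tailConst 3) * LogEulerProduct.tailConst 4) * Real.log X ^ (5 : ℕ) := by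
  have hg := isMultiplicative_gC c' D
  have hmaj : ∑ n ∈ Icc 1 X, gC c' D n / n ≤
      Real.exp (4 * (5 : ℕ) + 0 * Real.log (4 * X) + (60 + 7 * M0) +
        7 * (2 + LogEulerProduct.tailConst 3) * LogEulerProduct.tailConst 4) *
          Real.log X ^ (5 : ℕ) :=
    sum_div_le_gen (f := fun n => gC c' D n) hg.map_one
      (fun m n hmn => hg.map_mul_of_coprime hmn) (gC_nonneg c' D) (a := 5) (d := 4) (K := 0)
      (M := 60 + 7 * M0) (C₅ := 7 * (2 + LogEulerProduct.tailConst 3)) le_rfl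
      (by linarith [M0_nonneg]) (by linarith [LogEulerProduct.tailConst_nonneg 3]) hX
      (fun p hp => summable_gC_local c' D hp)
      (fun p hp _ => by
        have h := gC_prime_le c' D hp
        rw [zero_mul, add_zero]; push_cast; exact h)
      (fun p ν hp _ => gC_prime_pow_le c' D hp ν)
  refine le_trans (sum_le_sum fun n hn => ?_) hmaj
  have hn0 : n ≠ 0 := by have := (mem_Icc.mp hn).1; omega
  exact div_le_div_of_nonneg_right (norm_xiZero_le_gC c' D hn0 j d r) (Nat.cast_nonneg n)

omit c' D in
/-- **The logarithmic mean of `Λc`**: `Σ_{d≤X} Λc(d)/d ≤ exp(4 + 12 + 7S₀)·log X` (`X ≥ 2`).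
[cite: Zhang2022LandauSiegel, §7 p.33] -/
theorem sum_LamC_div_le {X : ℕ} (hX : 2 ≤ X) :
    ∑ d ∈ Icc 1 X, LamC d / d ≤
      Real.exp (4 * (1 : ℕ) + 0 * Real.log (4 * X) + 12 + 7 * LogEulerProduct.tailConst 0) *
        Real.log X ^ (1 : ℕ) := by
  have hg := isMultiplicative_LamC
  refine sum_div_le_gen (f := fun n => LamC n) hg.map_one
    (fun m n hmn => hg.map_mul_of_coprime hmn) LamC_nonneg (a := 1) (d := 0) (K := 0) (M := 12)
    (C₅ := 7) le_rfl (by norm_num) (by norm_num) hX (fun p hp => ?_) (fun p hp _ => ?_)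
    (fun p ν hp _ => ?_)
  · have hp2 : (2 : ℝ) ≤ p := by exact_mod_cast hp.two_le
    refine Summable.of_nonneg_of_le (fun ν => div_nonneg (LamC_nonneg _) (by positivity))
      (fun ν => ?_) ((summable_geometric_of_lt_one (by norm_num : (0 : ℝ) ≤ 1 / 2)
        (by norm_num)).mul_left 7)
    have hppos : (0 : ℝ) < (p : ℝ) ^ ν := by positivity
    rw [div_le_iff₀ hppos]
    have h1 : (1 : ℝ) ≤ (1 / 2 : ℝ) ^ ν * (p : ℝ) ^ ν := by
      rw [← mul_pow]; exact one_le_pow₀ (by linarith)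
    calc LamC (p ^ ν) ≤ 7 := LamC_prime_pow_le hp ν
      _ ≤ 7 * ((1 / 2 : ℝ) ^ ν * (p : ℝ) ^ ν) := le_mul_of_one_le_right (by norm_num) h1
      _ = 7 * (1 / 2 : ℝ) ^ ν * (p : ℝ) ^ ν := by ring
  · rw [LamC_apply hp.ne_zero, hp.primeFactors, prod_singleton, zero_mul, add_zero]
    push_cast; exact le_rfl
  · rw [pow_zero, mul_one]; exact LamC_prime_pow_le hp ν

omit c' D in
/-- **The harmonic sum**: `Σ_{m≤X} 1/m ≤ exp(4 + S₀)·log X` (`X ≥ 2`; the majorant applied to `f ≡ 1`).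
[cite: HallTenenbaum1988, (0.4)] -/
theorem sum_inv_le {X : ℕ} (hX : 2 ≤ X) :
    ∑ m ∈ Icc 1 X, (1 : ℝ) / m ≤
      Real.exp (4 * (1 : ℕ) + 0 * Real.log (4 * X) + 0 + 1 * LogEulerProduct.tailConst 0) *
        Real.log X ^ (1 : ℕ) := by
  refine sum_div_le_gen (f := fun _ => (1 : ℝ)) rfl (fun m n _ => (mul_one _).symm)
    (fun _ => zero_le_one) (a := 1) (d := 0) (K := 0) (M := 0) (C₅ := 1) le_rfl le_rfl
    zero_le_one hX (fun p hp => ?_) (fun p hp _ => by simp) (fun p ν hp _ => by simp)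
  have hp2 : (2 : ℝ) ≤ p := by exact_mod_cast hp.two_le
  refine Summable.of_nonneg_of_le (fun ν => by positivity) (fun ν => ?_)
    (summable_geometric_of_lt_one (by norm_num : (0 : ℝ) ≤ 1 / 2) (by norm_num))
  rw [one_div, ← inv_pow, one_div]
  exact pow_le_pow_left₀ (by positivity) (inv_anti₀ two_pos hp2) ν

/-! ### Part 4. The bound for `S_j` -/

omit c' D in
/-- `|μ(r)| ≤ 1` as a real number. [cite: Zhang2022LandauSiegel, §7 p.33] -/
theorem natAbs_moebius_le_one (r : ℕ) : ((ArithmeticFunction.moebius r).natAbs : ℝ) ≤ 1 := by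
  have h : ((ArithmeticFunction.moebius r).natAbs : ℤ) ≤ 1 := by
    rw [Int.natCast_natAbs]; exact ArithmeticFunction.abs_moebius_le_one
  exact_mod_cast h

/-- **One term of `S_j`**: for `d, r ≠ 0` and sequences with `|a₁|, |a₂| ≤ 1`,
`‖ |μ(r)|λ₀ⱼ(dr)/(drφ(r)) · (Σ_m a₁(drm)m^{−(1−β_j)}) · (Σ_n a₂(drn)ξ₀ⱼ(n;d,r)/n) ‖`
`≤ (Λc(d)/d)(Λc(r)/r) · (Σ_m 1/m) · (Σ_n |ξ₀ⱼ(n;d,r)|/n)` (sums over `m, n < N`).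
[cite: Zhang2022LandauSiegel, §7 Prop. 7.1 p.33] -/
theorem norm_Sj_term_le {d r : ℕ} (hd : d ≠ 0) (hr : r ≠ 0) (j N : ℕ) {a₁ a₂ : ℕ → ℂ}
    (ha₁ : ∀ n, ‖a₁ n‖ ≤ 1) (ha₂ : ∀ n, ‖a₂ n‖ ≤ 1) :
    ‖((ArithmeticFunction.moebius r).natAbs : ℂ) * Skeleton.lamZero c' D j (d * r) /
          ((d * r : ℕ) * (Nat.totient r : ℂ)) *
        (∑ m ∈ Ico 1 N, a₁ (d * r * m) / (m : ℂ) ^ (1 - Skeleton.betaJ c' D j)) *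
        (∑ n ∈ Ico 1 N, a₂ (d * r * n) * Skeleton.xiZero c' D j n d r / (n : ℂ))‖ ≤
      (LamC d / d) * (LamC r / r) * (∑ m ∈ Ico 1 N, (1 : ℝ) / m) *
        (∑ n ∈ Ico 1 N, ‖Skeleton.xiZero c' D j n d r‖ / n) := by
  have hdr : d * r ≠ 0 := mul_ne_zero hd hr
  have hdpos : (0 : ℝ) < d := by exact_mod_cast Nat.pos_of_ne_zero hd
  have hrpos : (0 : ℝ) < r := by exact_mod_cast Nat.pos_of_ne_zero hr
  have hφpos : (0 : ℝ) < Nat.totient r := by exact_mod_cast Nat.totient_pos.mpr (Nat.pos_of_ne_zero hr)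
  -- the weight
  have hw : ‖((ArithmeticFunction.moebius r).natAbs : ℂ) * Skeleton.lamZero c' D j (d * r) /
      ((d * r : ℕ) * (Nat.totient r : ℂ))‖ ≤ (LamC d / d) * (LamC r / r) := by
    rw [norm_div, norm_mul, norm_mul, Complex.norm_natCast, Complex.norm_natCast,
      Complex.norm_natCast]
    push_cast
    have hden : (0 : ℝ) < (d : ℝ) * r * Nat.totient r := by positivity
    have hlam : ‖Skeleton.lamZero c' D j (d * r)‖ ≤ LamC d * LamC r :=
      (norm_lamZero_le_LamC c' D hdr j).trans (LamC_mul_le hd hr)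
    have hμ := natAbs_moebius_le_one r
    have hφ1 : (1 : ℝ) ≤ Nat.totient r := by
      exact_mod_cast Nat.totient_pos.mpr (Nat.pos_of_ne_zero hr)
    have hnum : ((ArithmeticFunction.moebius r).natAbs : ℝ) * ‖Skeleton.lamZero c' D j (d * r)‖ ≤
        LamC d * LamC r := by
      calc ((ArithmeticFunction.moebius r).natAbs : ℝ) * ‖Skeleton.lamZero c' D j (d * r)‖
          ≤ 1 * (LamC d * LamC r) := mul_le_mul hμ hlam (norm_nonneg _) zero_le_one
        _ = _ := one_mul _
    have hden' : (d : ℝ) * r ≤ (d : ℝ) * r * Nat.totient r :=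
      le_mul_of_one_le_right (by positivity) hφ1
    calc ((ArithmeticFunction.moebius r).natAbs : ℝ) * ‖Skeleton.lamZero c' D j (d * r)‖ /
          ((d : ℝ) * r * Nat.totient r)
        ≤ (LamC d * LamC r) / ((d : ℝ) * r * Nat.totient r) :=
          div_le_div_of_nonneg_right hnum hden.le
      _ ≤ (LamC d * LamC r) / ((d : ℝ) * r) :=
          div_le_div_of_nonneg_left (mul_nonneg (LamC_nonneg d) (LamC_nonneg r))
            (by positivity) hden'
      _ = LamC d / d * (LamC r / r) := by rw [div_mul_div_comm]
  -- the `m`-sum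
  have hm : ‖∑ m ∈ Ico 1 N, a₁ (d * r * m) / (m : ℂ) ^ (1 - Skeleton.betaJ c' D j)‖ ≤
      ∑ m ∈ Ico 1 N, (1 : ℝ) / m := by
    refine (norm_sum_le _ _).trans (sum_le_sum fun m hm => ?_)
    have hmpos : 0 < m := (mem_Ico.mp hm).1
    rw [norm_div, Complex.norm_natCast_cpow_of_pos hmpos, one_sub_betaJ_re, Real.rpow_one]
    exact div_le_div_of_nonneg_right (ha₁ _) (Nat.cast_nonneg m)
  -- the `n`-sum
  have hn : ‖∑ n ∈ Ico 1 N, a₂ (d * r * n) * Skeleton.xiZero c' D j n d r / (n : ℂ)‖ ≤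
      ∑ n ∈ Ico 1 N, ‖Skeleton.xiZero c' D j n d r‖ / n := by
    refine (norm_sum_le _ _).trans (sum_le_sum fun n _ => ?_)
    rw [norm_div, norm_mul, Complex.norm_natCast]
    refine div_le_div_of_nonneg_right ?_ (Nat.cast_nonneg n)
    calc ‖a₂ (d * r * n)‖ * ‖Skeleton.xiZero c' D j n d r‖ ≤ 1 * ‖Skeleton.xiZero c' D j n d r‖ :=
        mul_le_mul_of_nonneg_right (ha₂ _) (norm_nonneg _)
      _ = _ := one_mul _
  have hw0 : 0 ≤ LamC d / d * (LamC r / r) :=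
    mul_nonneg (div_nonneg (LamC_nonneg d) hdpos.le) (div_nonneg (LamC_nonneg r) hrpos.le)
  have hm0 : 0 ≤ ∑ m ∈ Ico 1 N, (1 : ℝ) / m := sum_nonneg fun m _ => by positivity
  rw [norm_mul, norm_mul]
  exact mul_le_mul (mul_le_mul hw hm (norm_nonneg _) hw0) hn (norm_nonneg _)
    (mul_nonneg hw0 hm0)

/-- **`|S_j(𝐚₁,𝐚₂)| ≤ (Σ_{d≤N}Λc(d)/d)²·(Σ_{m≤N}1/m)·(max. `ξ₀ⱼ`-mean)** for `|a₁|, |a₂| ≤ 1`,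
`N = ⌈PT⁻²⌉ ≥ 2`: precisely
`≤ (C₂ log N)²·(C₃ log N)·C₁(log N)⁵` with the constants of the three mean values above.
[cite: Zhang2022LandauSiegel, §7 Prop. 7.1 p.33] -/
theorem norm_Sj_le {N : ℕ} (hN : Skeleton.Nsupp D = N) (hN2 : 2 ≤ N) (j : ℕ) {a₁ a₂ : ℕ → ℂ}
    (ha₁ : ∀ n, ‖a₁ n‖ ≤ 1) (ha₂ : ∀ n, ‖a₂ n‖ ≤ 1) :
    ‖Skeleton.Sj c' D j a₁ a₂‖ ≤
      (Real.exp (4 * (1 : ℕ) + 0 * Real.log (4 * N) + 12 + 7 * LogEulerProduct.tailConst 0) *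
          Real.log N ^ (1 : ℕ)) ^ 2 *
        (Real.exp (4 * (1 : ℕ) + 0 * Real.log (4 * N) + 0 + 1 * LogEulerProduct.tailConst 0) *
          Real.log N ^ (1 : ℕ)) *
        (Real.exp (4 * (5 : ℕ) + 0 * Real.log (4 * N) + (60 + 7 * M0) +
          7 * (2 + LogEulerProduct.tailConst 3) * LogEulerProduct.tailConst 4) *
            Real.log N ^ (5 : ℕ)) := by
  -- abbreviations for the three mean-value bounds
  set A : ℝ := Real.exp (4 * (1 : ℕ) + 0 * Real.log (4 * N) + 12 +
    7 * LogEulerProduct.tailConst 0) * Real.log N ^ (1 : ℕ) with hA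
  set H : ℝ := Real.exp (4 * (1 : ℕ) + 0 * Real.log (4 * N) + 0 +
    1 * LogEulerProduct.tailConst 0) * Real.log N ^ (1 : ℕ) with hH
  set Ξ : ℝ := Real.exp (4 * (5 : ℕ) + 0 * Real.log (4 * N) + (60 + 7 * M0) +
    7 * (2 + LogEulerProduct.tailConst 3) * LogEulerProduct.tailConst 4) *
      Real.log N ^ (5 : ℕ) with hΞ
  have hsubN : Ico 1 N ⊆ Icc 1 N := fun n hn => by
    rw [mem_Ico] at hn; rw [mem_Icc]; omega
  have hΛ : ∑ d ∈ Ico 1 N, LamC d / d ≤ A :=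
    (sum_le_sum_of_subset_of_nonneg hsubN fun d _ _ =>
      div_nonneg (LamC_nonneg d) (Nat.cast_nonneg d)).trans (sum_LamC_div_le hN2)
  have hHm : ∑ m ∈ Ico 1 N, (1 : ℝ) / m ≤ H :=
    (sum_le_sum_of_subset_of_nonneg hsubN fun m _ _ => by positivity).trans (sum_inv_le hN2)
  have hΞn : ∀ d r : ℕ, ∑ n ∈ Ico 1 N, ‖Skeleton.xiZero c' D j n d r‖ / n ≤ Ξ := fun d r =>
    (sum_le_sum_of_subset_of_nonneg hsubN fun n _ _ =>
      div_nonneg (norm_nonneg _) (Nat.cast_nonneg n)).trans (sum_norm_xiZero_div_le c' D hN2 j d r)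
  have hH0 : 0 ≤ H := le_trans (sum_nonneg fun m _ => by positivity) hHm
  have hΞ0 : 0 ≤ Ξ := le_trans (sum_nonneg fun n _ => div_nonneg (norm_nonneg _)
    (Nat.cast_nonneg n)) (hΞn 1 1)
  rw [Skeleton.Sj, hN]
  calc ‖∑ d ∈ Ico 1 N, ∑ r ∈ Ico 1 N,
          ((ArithmeticFunction.moebius r).natAbs : ℂ) * Skeleton.lamZero c' D j (d * r) /
              ((d * r : ℕ) * (Nat.totient r : ℂ)) *
            (∑ m ∈ Ico 1 N, a₁ (d * r * m) / (m : ℂ) ^ (1 - Skeleton.betaJ c' D j)) *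
            (∑ n ∈ Ico 1 N, a₂ (d * r * n) * Skeleton.xiZero c' D j n d r / (n : ℂ))‖
      ≤ ∑ d ∈ Ico 1 N, ∑ r ∈ Ico 1 N,
          (LamC d / d) * (LamC r / r) * (∑ m ∈ Ico 1 N, (1 : ℝ) / m) *
            (∑ n ∈ Ico 1 N, ‖Skeleton.xiZero c' D j n d r‖ / n) := by
        refine (norm_sum_le _ _).trans (sum_le_sum fun d hd => ?_)
        refine (norm_sum_le _ _).trans (sum_le_sum fun r hr => ?_)
        have hd0 : d ≠ 0 := by have := (mem_Ico.mp hd).1; omega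
        have hr0 : r ≠ 0 := by have := (mem_Ico.mp hr).1; omega
        exact norm_Sj_term_le c' D hd0 hr0 j N ha₁ ha₂
    _ ≤ ∑ d ∈ Ico 1 N, ∑ r ∈ Ico 1 N, (LamC d / d) * (LamC r / r) * H * Ξ := by
        refine sum_le_sum fun d _ => sum_le_sum fun r _ => ?_
        have hw0 : 0 ≤ LamC d / d * (LamC r / r) :=
          mul_nonneg (div_nonneg (LamC_nonneg d) (Nat.cast_nonneg d))
            (div_nonneg (LamC_nonneg r) (Nat.cast_nonneg r))
        exact mul_le_mul (mul_le_mul_of_nonneg_left hHm hw0) (hΞn d r)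
          (sum_nonneg fun n _ => div_nonneg (norm_nonneg _) (Nat.cast_nonneg n))
          (mul_nonneg hw0 hH0)
    _ = (∑ d ∈ Ico 1 N, LamC d / d) * (∑ r ∈ Ico 1 N, LamC r / r) * H * Ξ := by
        rw [sum_mul_sum]
        simp_rw [sum_mul]
    _ ≤ A * A * H * Ξ := by
        have hs0 : 0 ≤ ∑ d ∈ Ico 1 N, LamC d / d :=
          sum_nonneg fun d _ => div_nonneg (LamC_nonneg d) (Nat.cast_nonneg d)
        have hA0 : 0 ≤ A := hs0.trans hΛ
        have h2 : (∑ d ∈ Ico 1 N, LamC d / d) * (∑ r ∈ Ico 1 N, LamC r / r) ≤ A * A :=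
          mul_le_mul hΛ hΛ hs0 hA0
        exact mul_le_mul_of_nonneg_right (mul_le_mul_of_nonneg_right h2 hH0) hΞ0
    _ = A ^ 2 * H * Ξ := by ring

/-- **`SjPolylog` HOLDS with `B = 72`**: there is an absolute `K` with
`|S_j(𝐚₁,𝐚₂)| ≤ K·𝓛⁷²` for all large `D`, all `j ∈ {1,2,3}` and all sequences `𝐚₁, 𝐚₂` that are
admissible in the sense of (7.2) with `|a| ≤ 1` — the hypothesis `hS` of
`Section11E2MeanSquare.step11u027_of_sjPolylog` / `dmv_of_lemma81_prop71`, verbatim with `B := 72`.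
Route: `norm_Sj_le` with `N = ⌈PT⁻²⌉`, `2 ≤ N ≤ 2P`, `log N ≤ 2𝓛⁹` for `𝓛 ≥ 3`.
[cite: Zhang2022LandauSiegel, §7 Prop. 7.1 p.33; §11 p.65] -/
theorem sjPolylog (c' : ℝ) : ∃ K : ℝ, Skeleton.ForAllLarge fun D _ _ =>
    ∀ j ∈ ({1, 2, 3} : Finset ℕ), ∀ a₁ a₂ : ℕ → ℂ,
      Skeleton.Adm72 D 1 a₁ → Skeleton.Adm72 D 1 a₂ →
        ‖Skeleton.Sj c' D j a₁ a₂‖ ≤ K * Skeleton.ell D ^ 72 := by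
  -- the absolute constants
  set E₂ : ℝ := Real.exp (4 * ((1 : ℕ) : ℝ) + 12 + 7 * LogEulerProduct.tailConst 0) with hE₂
  set E₃ : ℝ := Real.exp (4 * ((1 : ℕ) : ℝ) + 1 * LogEulerProduct.tailConst 0) with hE₃
  set E₁ : ℝ := Real.exp (4 * ((5 : ℕ) : ℝ) + (60 + 7 * M0) +
    7 * (2 + LogEulerProduct.tailConst 3) * LogEulerProduct.tailConst 4) with hE₁
  refine ⟨E₂ ^ 2 * E₃ * E₁ * 2 ^ 8, ⌈Real.exp 3⌉₊, fun D _ χ hD _ _ j _ a₁ a₂ ha₁ ha₂ => ?_⟩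
  -- `𝓛 ≥ 3`
  have hexp3 : Real.exp 3 ≤ D := le_trans (Nat.le_ceil _) (by exact_mod_cast hD)
  have hL3 : 3 ≤ Skeleton.ell D := by
    rw [Skeleton.ell]
    exact (Real.le_log_iff_exp_le (lt_of_lt_of_le (Real.exp_pos _) hexp3)).mpr hexp3
  have hPT : Skeleton.bigP D / Skeleton.bigT D ^ 2 =
      Real.exp (Skeleton.ell D ^ 9 - 2 * Skeleton.ell D ^ (1.1 : ℝ)) := by
    rw [Skeleton.bigP, Skeleton.bigT, ← Real.exp_nat_mul, ← Real.exp_sub]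
    push_cast
    rfl
  set ℓ := Skeleton.ell D with hℓ
  have hℓ1 : 1 ≤ ℓ := by linarith
  -- `N = ⌈PT⁻²⌉`, `2 ≤ N`, `log N ≤ 2𝓛⁹`
  set N : ℕ := Skeleton.Nsupp D with hNdef
  have hl11 : ℓ ^ (1.1 : ℝ) ≤ ℓ ^ 2 := by
    calc ℓ ^ (1.1 : ℝ) ≤ ℓ ^ (2 : ℝ) := Real.rpow_le_rpow_of_exponent_le hℓ1 (by norm_num)
      _ = ℓ ^ 2 := Real.rpow_two ℓ
  have hl9 : 2 * ℓ ^ 2 + 1 ≤ ℓ ^ 9 := by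
    have h7 : (2187 : ℝ) ≤ ℓ ^ 7 := by
      calc (2187 : ℝ) = 3 ^ 7 := by norm_num
        _ ≤ ℓ ^ 7 := pow_le_pow_left₀ (by norm_num) hL3 7
    have hl2 : 1 ≤ ℓ ^ 2 := one_le_pow₀ hℓ1
    nlinarith
  have hN2r : (2 : ℝ) ≤ N := by
    have h1 : Real.exp 1 ≤ Skeleton.bigP D / Skeleton.bigT D ^ 2 := by
      rw [hPT]; exact Real.exp_le_exp.mpr (by linarith)
    have h2 : (2 : ℝ) ≤ Real.exp 1 := by
      have := Real.add_one_le_exp (1 : ℝ); linarith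
    calc (2 : ℝ) ≤ Skeleton.bigP D / Skeleton.bigT D ^ 2 := h2.trans h1
      _ ≤ N := by rw [hNdef, Skeleton.Nsupp]; exact Nat.le_ceil _
  have hN2 : 2 ≤ N := by exact_mod_cast hN2r
  have hNpos : (0 : ℝ) < N := by linarith
  have hP1 : 1 ≤ Skeleton.bigP D := by
    rw [Skeleton.bigP]; exact Real.one_le_exp (by positivity)
  have hT1 : 1 ≤ Skeleton.bigT D := by
    rw [Skeleton.bigT]; exact Real.one_le_exp (by positivity)
  have hNle : (N : ℝ) ≤ 2 * Skeleton.bigP D := by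
    have h1 : (N : ℝ) < Skeleton.bigP D / Skeleton.bigT D ^ 2 + 1 := by
      rw [hNdef, Skeleton.Nsupp]; exact Nat.ceil_lt_add_one (by positivity)
    have h2 : Skeleton.bigP D / Skeleton.bigT D ^ 2 ≤ Skeleton.bigP D := by
      refine div_le_self (by linarith) (one_le_pow₀ hT1)
    linarith
  have hlogN : Real.log N ≤ 2 * ℓ ^ 9 := by
    calc Real.log N ≤ Real.log (2 * Skeleton.bigP D) := Real.log_le_log hNpos hNle
      _ = Real.log 2 + ℓ ^ 9 := by
          rw [Real.log_mul (by norm_num) (by linarith), Skeleton.bigP, Real.log_exp]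
      _ ≤ 1 + ℓ ^ 9 := by
          have := Real.log_le_sub_one_of_pos (show (0:ℝ) < 2 by norm_num); linarith
      _ ≤ 2 * ℓ ^ 9 := by linarith [one_le_pow₀ (n := 9) hℓ1]
  have hlogN0 : 0 ≤ Real.log N := Real.log_nonneg (by linarith)
  -- the pointwise bound
  have hmain := norm_Sj_le c' D hNdef.symm hN2 j ha₁.1 ha₂.1
  simp only [zero_mul, add_zero, pow_one] at hmain
  rw [← hE₂, ← hE₃, ← hE₁] at hmain
  have hE₂0 : 0 ≤ E₂ := (Real.exp_pos _).le
  have hE₃0 : 0 ≤ E₃ := (Real.exp_pos _).le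
  have hE₁0 : 0 ≤ E₁ := (Real.exp_pos _).le
  have hpow8 : Real.log N ^ 8 ≤ 2 ^ 8 * ℓ ^ 72 := by
    calc Real.log N ^ 8 ≤ (2 * ℓ ^ 9) ^ 8 := pow_le_pow_left₀ hlogN0 hlogN 8
      _ = 2 ^ 8 * ℓ ^ 72 := by ring
  calc ‖Skeleton.Sj c' D j a₁ a₂‖
      ≤ (E₂ * Real.log N) ^ 2 * (E₃ * Real.log N) * (E₁ * Real.log N ^ 5) := hmain
    _ = E₂ ^ 2 * E₃ * E₁ * Real.log N ^ 8 := by ring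
    _ ≤ E₂ ^ 2 * E₃ * E₁ * (2 ^ 8 * ℓ ^ 72) :=
        mul_le_mul_of_nonneg_left hpow8 (by positivity)
    _ = E₂ ^ 2 * E₃ * E₁ * 2 ^ 8 * ℓ ^ 72 := by ring

end Literature.NumberTheory.LFunctions.Zhang2022.XiZeroMajorant
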